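import Literature.NumberTheory.Transcendental.BinomialAntiEFunction
import HarnessLib

/-!
# The binomial Э-function: `z²𝔣′ + (1 − sz)𝔣 = 1` formally, uniqueness, and `𝔣 ∉ ℂ(z)` for `s ∉ ℤ_{≥0}`

`Literature/NumberTheory/Transcendental/BinomialAntiEFunctionODE.lean` — everything PROVED. The
FORMAL sentences of the proof of [FischlerRivoal2024, Corollary 1] (§5.2): "The Э-function
`𝔣(z) := ∑ s(s−1)⋯(s−n+1) zⁿ` is solution of the inhomogeneous differential equation
`z²𝔣′(z) + (1−sz)𝔣(z) − 1 = 0`, which can be immediately transformed into a differential system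
satisfied by the vector of Э-functions `ᵗ(1, 𝔣(z))`. … Moreover, `𝔣(z)` is a transcendental
function because `s ∉ ℤ_{≥0}`."  Here `𝔣 = antiESeries (C(s,·)) = ∑ n!·C(s,n) zⁿ ∈ ℂ⟦z⟧`
(`AntiEFunction.lean`), for any `s ∈ ℂ`:

* `coeff_antiESeries_ringChoose_succ` — the coefficients `hₙ = n! C(s,n) = s(s−1)⋯(s−n+1)` satisfy
  `hₙ₊₁ = (s − n) hₙ`, `h₀ = 1`;
* `antiESeries_ringChoose_ode` — `X² 𝔣′ + (1 − sX) 𝔣 = 1` in `ℂ⟦X⟧`;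
* `eq_antiESeries_ringChoose_of_ode` — `𝔣` is the UNIQUE formal power-series solution;
* `antiESeries_ringChoose_not_ratFunc` — for `s ∉ ℤ_{≥0}`, `𝔣` is not (the expansion of) a
  rational function: `Q · 𝔣 = P` with polynomials `P, Q` forces `Q = 0` (the coefficients of a
  rational series grow at most geometrically — `exists_geometric_bound_of_polynomial_mul_eq` —,
  while no `hₙ` vanishes and `|hₙ₊₁/hₙ| = |s − n| → ∞`). This is what "transcendental function"
  is used for in Theorem 3 applied to `ᵗ(1, 𝔣)` (linear independence of `1, 𝔣` over `ℚ̄(z)`,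
  and the final contradiction `B𝔣 = −A`, `B(1/α) ≠ 0`).

## References

* [FischlerRivoal2024] S. Fischler, T. Rivoal, J. Number Theory 261 (2024), §5.2.
-/

noncomputable section

open Finset Complex
open scoped Nat

namespace Literature.NumberTheory.Transcendental

open Literature.Barriers.Schanuel Literature.RingTheory.Binomial

variable (s : ℂ)

/-! ### 1. The coefficients `hₙ = s(s−1)⋯(s−n+1)` -/

/-- `[zⁿ] 𝔣 = n!·C(s,n) = ∏_{i<n} (s − i) = s(s−1)⋯(s−n+1)`. [cite: FischlerRivoal2024, §5.2] -/
theorem coeff_antiESeries_ringChoose (n : ℕ) :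
    PowerSeries.coeff n (antiESeries fun k => Ring.choose s k) = ∏ i ∈ Finset.range n, (s - i) := by
  rw [coeff_antiESeries, ringChoose_eq_prod_range_div]
  have hn : (n ! : ℂ) ≠ 0 := by exact_mod_cast n.factorial_ne_zero
  field_simp

/-- The first-order recurrence `hₙ₊₁ = (s − n) hₙ`. [folklore] -/
theorem coeff_antiESeries_ringChoose_succ (n : ℕ) :
    PowerSeries.coeff (n + 1) (antiESeries fun k => Ring.choose s k) =
      (s - n) * PowerSeries.coeff n (antiESeries fun k => Ring.choose s k) := by
  rw [coeff_antiESeries_ringChoose, coeff_antiESeries_ringChoose, Finset.prod_range_succ, mul_comm]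

/-- `h₀ = 1`. [folklore] -/
theorem coeff_zero_antiESeries_ringChoose :
    PowerSeries.coeff 0 (antiESeries fun k => Ring.choose s k) = 1 := by
  rw [coeff_antiESeries_ringChoose, Finset.prod_range_zero]

/-- No coefficient vanishes when `s ∉ ℤ_{≥0}`. [folklore] -/
theorem coeff_antiESeries_ringChoose_ne_zero (hs : ∀ n : ℕ, s ≠ n) (n : ℕ) :
    PowerSeries.coeff n (antiESeries fun k => Ring.choose s k) ≠ 0 := by
  rw [coeff_antiESeries_ringChoose]
  exact Finset.prod_ne_zero_iff.2 fun i _ => sub_ne_zero.2 (hs i)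

/-! ### 2. The inhomogeneous equation `z²𝔣′ + (1 − sz)𝔣 = 1` and its uniqueness -/

/-- Coefficients of `X² f′ + (1 − sX) f`: `[zⁿ⁺¹] = fₙ₊₁ − (s − n) fₙ`. [folklore] -/
theorem coeff_succ_binomialODE_lhs (f : PowerSeries ℂ) (n : ℕ) :
    PowerSeries.coeff (n + 1) (PowerSeries.X ^ 2 * PowerSeries.derivative ℂ f
      + (1 - PowerSeries.C s * PowerSeries.X) * f) =
      PowerSeries.coeff (n + 1) f - (s - n) * PowerSeries.coeff n f := by
  rw [map_add, sub_mul, one_mul, map_sub, mul_assoc, PowerSeries.coeff_C_mul,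
    PowerSeries.coeff_succ_X_mul, pow_two, mul_assoc]
  rcases n with _ | n
  · rw [PowerSeries.coeff_succ_X_mul, PowerSeries.coeff_zero_X_mul]
    simp
  · rw [PowerSeries.coeff_succ_X_mul, PowerSeries.coeff_succ_X_mul, PowerSeries.coeff_derivative]
    push_cast
    ring

/-- Constant coefficient of `X² f′ + (1 − sX) f` is `f₀`. [folklore] -/
theorem coeff_zero_binomialODE_lhs (f : PowerSeries ℂ) :
    PowerSeries.coeff 0 (PowerSeries.X ^ 2 * PowerSeries.derivative ℂ f
      + (1 - PowerSeries.C s * PowerSeries.X) * f) = PowerSeries.coeff 0 f := by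
  rw [map_add, sub_mul, one_mul, map_sub, mul_assoc, PowerSeries.coeff_C_mul,
    PowerSeries.coeff_zero_X_mul, pow_two, mul_assoc, PowerSeries.coeff_zero_X_mul]
  simp

/-- **`z² 𝔣′(z) + (1 − sz) 𝔣(z) − 1 = 0`** formally in `ℂ⟦z⟧`, for `𝔣 = ∑ s(s−1)⋯(s−n+1) zⁿ`.
PROVED. [cite: FischlerRivoal2024, §5.2] -/
theorem antiESeries_ringChoose_ode :
    PowerSeries.X ^ 2 * PowerSeries.derivative ℂ (antiESeries fun k => Ring.choose s k)
      + (1 - PowerSeries.C s * PowerSeries.X) * (antiESeries fun k => Ring.choose s k) = 1 := by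
  ext n
  rcases n with _ | n
  · rw [coeff_zero_binomialODE_lhs, coeff_zero_antiESeries_ringChoose, PowerSeries.coeff_one]
    simp
  · rw [coeff_succ_binomialODE_lhs, coeff_antiESeries_ringChoose_succ, sub_self,
      PowerSeries.coeff_one]
    simp

/-- **Uniqueness of the formal solution**: a formal power series `f` with
`X² f′ + (1 − sX) f = 1` is `𝔣` (its coefficients obey `f₀ = 1`, `fₙ₊₁ = (s−n) fₙ`). PROVED.
[cite: FischlerRivoal2024, §5.2] -/
theorem eq_antiESeries_ringChoose_of_ode {f : PowerSeries ℂ}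
    (hf : PowerSeries.X ^ 2 * PowerSeries.derivative ℂ f
      + (1 - PowerSeries.C s * PowerSeries.X) * f = 1) :
    f = antiESeries fun k => Ring.choose s k := by
  ext n
  induction n with
  | zero =>
    have := congrArg (PowerSeries.coeff 0) hf
    rw [coeff_zero_binomialODE_lhs, PowerSeries.coeff_one] at this
    rw [coeff_zero_antiESeries_ringChoose]
    simpa using this
  | succ n ih =>
    have := congrArg (PowerSeries.coeff (n + 1)) hf
    rw [coeff_succ_binomialODE_lhs, PowerSeries.coeff_one] at this
    simp only [Nat.succ_ne_zero, if_false] at this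
    rw [coeff_antiESeries_ringChoose_succ, ← ih]
    exact sub_eq_zero.1 this

/-! ### 3. `𝔣` is not a rational function when `s ∉ ℤ_{≥0}` -/

/-- Sums of `‖qᵢ‖` beyond the degree do not grow. [folklore] -/
theorem sum_range_norm_coeff_le (Q : Polynomial ℂ) (K : ℕ) :
    ∑ i ∈ Finset.range K, ‖Q.coeff i‖ ≤ ∑ i ∈ Finset.range (Q.natDegree + 1), ‖Q.coeff i‖ := by
  rcases le_or_gt K (Q.natDegree + 1) with hle | hlt
  · exact Finset.sum_le_sum_of_subset_of_nonneg (Finset.range_mono hle) fun _ _ _ => norm_nonneg _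
  · rw [← Finset.sum_range_add_sum_Ico _ hlt.le]
    have : ∑ i ∈ Finset.Ico (Q.natDegree + 1) K, ‖Q.coeff i‖ = 0 := by
      refine Finset.sum_eq_zero fun i hi => ?_
      rw [Finset.mem_Ico] at hi
      rw [Polynomial.coeff_eq_zero_of_natDegree_lt (by omega), norm_zero]
    rw [this, add_zero]

/-- **Geometric growth from a rational presentation**: if `Q · f = P` in `ℂ⟦X⟧` with
`Q(0) ≠ 0` then `‖fₙ‖ ≤ A · Bⁿ` for some `A, B ≥ 1` (from the recurrence
`q₀ fₙ = pₙ − ∑_{1≤j≤n} q_j f_{n−j}`). [folklore] -/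
theorem exists_geometric_bound_of_polynomial_mul_eq {f : PowerSeries ℂ} {P Q : Polynomial ℂ}
    (hQ0 : Q.coeff 0 ≠ 0) (h : (Q : PowerSeries ℂ) * f = P) :
    ∃ A B : ℝ, 1 ≤ A ∧ 1 ≤ B ∧ ∀ n, ‖PowerSeries.coeff n f‖ ≤ A * B ^ n := by
  set q0 := Q.coeff 0 with hq0
  set S : ℝ := ∑ j ∈ Finset.range (Q.natDegree + 1), ‖Q.coeff j‖ with hS
  set M : ℝ := ∑ j ∈ Finset.range (P.natDegree + 1), ‖P.coeff j‖ with hM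
  have hS0 : 0 ≤ S := Finset.sum_nonneg fun _ _ => norm_nonneg _
  have hM0 : 0 ≤ M := Finset.sum_nonneg fun _ _ => norm_nonneg _
  have hq0pos : 0 < ‖q0‖ := norm_pos_iff.2 hQ0
  set B : ℝ := 1 + S / ‖q0‖ with hB
  set A : ℝ := 1 + M / ‖q0‖ with hA
  have hB1 : 1 ≤ B := by rw [hB]; have := div_nonneg hS0 hq0pos.le; linarith
  have hA1 : 1 ≤ A := by rw [hA]; have := div_nonneg hM0 hq0pos.le; linarith
  refine ⟨A, B, hA1, hB1, fun n => ?_⟩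
  -- coefficientwise identity `∑_{j ≤ n} q_j f_{n-j} = p_n`
  have hcoeff : ∀ n, ∑ j ∈ Finset.range (n + 1), Q.coeff j * PowerSeries.coeff (n - j) f =
      P.coeff n := by
    intro n
    have := congrArg (PowerSeries.coeff n) h
    rw [PowerSeries.coeff_mul, Finset.Nat.sum_antidiagonal_eq_sum_range_succ
      (fun i j => PowerSeries.coeff i (Q : PowerSeries ℂ) * PowerSeries.coeff j f),
      Polynomial.coeff_coe] at this
    simpa only [Polynomial.coeff_coe] using this
  have hPle : ∀ n, ‖P.coeff n‖ ≤ M := by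
    intro n
    have h1 : ‖P.coeff n‖ ≤ ∑ i ∈ Finset.range (n + 1), ‖P.coeff i‖ :=
      Finset.single_le_sum (f := fun j => ‖P.coeff j‖) (fun _ _ => norm_nonneg _)
        (Finset.self_mem_range_succ n)
    exact h1.trans (sum_range_norm_coeff_le P (n + 1))
  -- strong induction on `n`
  induction n using Nat.strong_induction_on with
  | _ n ih =>
    rcases n with _ | n
    · -- `q0 f0 = p0`
      have key := hcoeff 0
      rw [Finset.sum_range_one, Nat.sub_zero] at key
      have hf0 : PowerSeries.coeff 0 f = P.coeff 0 / q0 := by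
        rw [eq_div_iff hQ0]; linear_combination key
      rw [hf0, norm_div, pow_zero, mul_one, div_le_iff₀ hq0pos]
      calc ‖P.coeff 0‖ ≤ M := hPle 0
        _ = (A - 1) * ‖q0‖ := by rw [hA]; field_simp; ring
        _ ≤ A * ‖q0‖ := by nlinarith
    · have key := hcoeff (n + 1)
      rw [Finset.sum_range_succ', Nat.sub_zero] at key
      -- `q0 f_{n+1} = p_{n+1} − ∑_{j ≤ n} q_{j+1} f_{n-j}`
      have hfn : PowerSeries.coeff (n + 1) f =
          (P.coeff (n + 1)
            - ∑ j ∈ Finset.range (n + 1), Q.coeff (j + 1) * PowerSeries.coeff (n + 1 - (j + 1)) f)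
            / q0 := by
        rw [eq_div_iff hQ0]
        linear_combination key
      have hsum : ‖∑ j ∈ Finset.range (n + 1),
          Q.coeff (j + 1) * PowerSeries.coeff (n + 1 - (j + 1)) f‖ ≤ S * (A * B ^ n) := by
        calc ‖∑ j ∈ Finset.range (n + 1), Q.coeff (j + 1) * PowerSeries.coeff (n + 1 - (j + 1)) f‖
            ≤ ∑ j ∈ Finset.range (n + 1), ‖Q.coeff (j + 1) * PowerSeries.coeff (n + 1 - (j + 1)) f‖ :=
              norm_sum_le _ _
          _ ≤ ∑ j ∈ Finset.range (n + 1), ‖Q.coeff (j + 1)‖ * (A * B ^ n) := by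
              refine Finset.sum_le_sum fun j hj => ?_
              rw [norm_mul]
              have hjn : n + 1 - (j + 1) < n + 1 := by omega
              refine mul_le_mul_of_nonneg_left ((ih _ hjn).trans ?_) (norm_nonneg _)
              have hle : n + 1 - (j + 1) ≤ n := by omega
              have hA0 : 0 ≤ A := by linarith
              exact mul_le_mul_of_nonneg_left (pow_le_pow_right₀ hB1 hle) hA0
          _ = (∑ j ∈ Finset.range (n + 1), ‖Q.coeff (j + 1)‖) * (A * B ^ n) := by
              rw [Finset.sum_mul]
          _ ≤ S * (A * B ^ n) := by
              refine mul_le_mul_of_nonneg_right ?_ (by positivity)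
              have h1 : ∑ j ∈ Finset.range (n + 1), ‖Q.coeff (j + 1)‖ ≤
                  ∑ j ∈ Finset.range (n + 2), ‖Q.coeff j‖ := by
                rw [Finset.sum_range_succ' (fun j => ‖Q.coeff j‖)]
                linarith [norm_nonneg (Q.coeff 0)]
              exact h1.trans (sum_range_norm_coeff_le Q (n + 2))
      rw [hfn, norm_div, div_le_iff₀ hq0pos]
      have hBn1 : 1 ≤ B ^ n := one_le_pow₀ hB1
      have h1 : M = (A - 1) * ‖q0‖ := by rw [hA]; field_simp; ring
      have h2 : S = (B - 1) * ‖q0‖ := by rw [hB]; field_simp; ring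
      calc ‖P.coeff (n + 1)
            - ∑ j ∈ Finset.range (n + 1), Q.coeff (j + 1) * PowerSeries.coeff (n + 1 - (j + 1)) f‖
          ≤ ‖P.coeff (n + 1)‖
            + ‖∑ j ∈ Finset.range (n + 1), Q.coeff (j + 1) * PowerSeries.coeff (n + 1 - (j + 1)) f‖ :=
            norm_sub_le _ _
        _ ≤ M + S * (A * B ^ n) := add_le_add (hPle _) hsum
        _ = ((A - 1) + (B - 1) * (A * B ^ n)) * ‖q0‖ := by rw [h1, h2]; ring
        _ ≤ A * B ^ (n + 1) * ‖q0‖ := by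
            refine mul_le_mul_of_nonneg_right ?_ hq0pos.le
            rw [pow_succ]
            nlinarith [mul_le_mul_of_nonneg_left hBn1 (by linarith : (0 : ℝ) ≤ A)]

/-- **`𝔣` is a transcendental (indeed non-rational) formal series for `s ∉ ℤ_{≥0}`**: if
`Q · 𝔣 = P` in `ℂ⟦z⟧` for polynomials `P, Q ∈ ℂ[z]`, then `Q = 0` ("`𝔣(z)` is a transcendental
function because `s ∉ ℤ_{≥0}`": its coefficients `hₙ` never vanish and `hₙ₊₁/hₙ = s − n` is
unbounded, which no rational series allows). PROVED. [cite: FischlerRivoal2024, §5.2] -/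
theorem antiESeries_ringChoose_not_ratFunc (hs : ∀ n : ℕ, s ≠ n) {P Q : Polynomial ℂ}
    (h : (Q : PowerSeries ℂ) * (antiESeries fun k => Ring.choose s k) = P) : Q = 0 := by
  set f := antiESeries fun k => Ring.choose s k with hf
  -- induction on the degree of `Q`, peeling off factors `X` while `Q(0) = 0`
  induction hd : Q.natDegree using Nat.strong_induction_on generalizing P Q with
  | _ d ih =>
    by_contra hQ
    by_cases hQ0 : Q.coeff 0 = 0
    · -- `Q = Q.divX * X`, `P = P.divX * X`, cancel `X`
      have hQeq : Q = Q.divX * Polynomial.X := by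
        have := Polynomial.divX_mul_X_add Q
        rw [hQ0, map_zero, add_zero] at this
        exact this.symm
      have hP0 : P.coeff 0 = 0 := by
        have := congrArg (PowerSeries.coeff 0) h
        rw [hQeq, Polynomial.coe_mul, Polynomial.coe_X, mul_assoc, mul_comm, mul_assoc,
          PowerSeries.coeff_zero_X_mul, Polynomial.coeff_coe] at this
        exact this.symm
      have hPeq : P = P.divX * Polynomial.X := by
        have := Polynomial.divX_mul_X_add P
        rw [hP0, map_zero, add_zero] at this
        exact this.symm
      have h' : ((Q.divX : Polynomial ℂ) : PowerSeries ℂ) * f = (P.divX : Polynomial ℂ) := by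
        have hX : (PowerSeries.X : PowerSeries ℂ) ≠ 0 := PowerSeries.X_ne_zero
        apply mul_right_cancel₀ hX
        have := h
        rw [hQeq, hPeq, Polynomial.coe_mul, Polynomial.coe_mul, Polynomial.coe_X] at this
        calc ((Q.divX : Polynomial ℂ) : PowerSeries ℂ) * f * PowerSeries.X
            = ((Q.divX : Polynomial ℂ) : PowerSeries ℂ) * PowerSeries.X * f := by ring
          _ = ((P.divX : Polynomial ℂ) : PowerSeries ℂ) * PowerSeries.X := this
      have hdivX : Q.divX ≠ 0 := by
        intro h0
        apply hQ
        rw [hQeq, h0, zero_mul]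
      have hlt : Q.divX.natDegree < d := by
        rw [← hd, Polynomial.natDegree_divX_eq_natDegree_tsub_one]
        have : Q.natDegree ≠ 0 := by
          intro h0
          apply hdivX
          rw [Polynomial.divX_eq_zero_iff]
          exact Polynomial.eq_C_of_natDegree_eq_zero h0
        omega
      exact hdivX (ih _ hlt h' rfl)
    · -- `Q(0) ≠ 0`: geometric bound versus factorial growth
      obtain ⟨A, B, hA1, hB1, hbound⟩ := exists_geometric_bound_of_polynomial_mul_eq hQ0 h
      have hne := coeff_antiESeries_ringChoose_ne_zero s hs
      have hrec := coeff_antiESeries_ringChoose_succ s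
      obtain ⟨N, hN⟩ := exists_nat_ge (‖s‖ + 2 * B)
      have hB0 : 0 < B := by linarith
      -- `‖h_{N+j}‖ ≥ (2B)^j ‖h_N‖`
      have hgrow : ∀ j, (2 * B) ^ j * ‖PowerSeries.coeff N f‖ ≤ ‖PowerSeries.coeff (N + j) f‖ := by
        intro j
        induction j with
        | zero => simp
        | succ j ihj =>
          rw [← Nat.add_assoc, hf, hrec, ← hf, norm_mul, pow_succ]
          push_cast
          have hsn : 2 * B ≤ ‖s - ((N : ℂ) + (j : ℂ))‖ := by
            have h1 : ‖(N : ℂ) + (j : ℂ)‖ - ‖s‖ ≤ ‖s - ((N : ℂ) + (j : ℂ))‖ := by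
              rw [norm_sub_rev]; exact norm_sub_norm_le _ _
            have h2 : ‖(N : ℂ) + (j : ℂ)‖ = (N : ℝ) + j := by
              rw [show (N : ℂ) + (j : ℂ) = ((N + j : ℕ) : ℂ) by push_cast; ring,
                Complex.norm_natCast]
              push_cast
              ring
            have hj0 : (0 : ℝ) ≤ j := Nat.cast_nonneg j
            linarith
          calc (2 * B) ^ j * (2 * B) * ‖PowerSeries.coeff N f‖
              = 2 * B * ((2 * B) ^ j * ‖PowerSeries.coeff N f‖) := by ring
            _ ≤ ‖s - ((N : ℂ) + (j : ℂ))‖ * ‖PowerSeries.coeff (N + j) f‖ :=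
              mul_le_mul hsn ihj (by positivity) (norm_nonneg _)
      have hN0 : 0 < ‖PowerSeries.coeff N f‖ := norm_pos_iff.2 (hne N)
      -- hence `2^j ‖h_N‖ ≤ A B^N` for all `j`, absurd
      have hall : ∀ j : ℕ, (2 : ℝ) ^ j * ‖PowerSeries.coeff N f‖ ≤ A * B ^ N := by
        intro j
        have h1 := (hgrow j).trans (hbound (N + j))
        rw [mul_pow, pow_add] at h1
        have hBj : 0 < B ^ j := pow_pos hB0 j
        have h2 : ((2 : ℝ) ^ j * ‖PowerSeries.coeff N f‖) * B ^ j ≤ (A * B ^ N) * B ^ j := by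
          nlinarith
        exact le_of_mul_le_mul_right h2 hBj
      obtain ⟨j, hj⟩ := pow_unbounded_of_one_lt (A * B ^ N / ‖PowerSeries.coeff N f‖) one_lt_two
      have := hall j
      rw [div_lt_iff₀ hN0] at hj
      linarith

end Literature.NumberTheory.Transcendental

end
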